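import Summits.QuantumFields.YangMills.Theorems.BalabanUVNodesRateCarriersOfRecord11
import Summits.QuantumFields.YangMills.Theorems.BalabanUVNodesN17AtRecord11Keys

/-!
# BalabanUVNodes ∕ node N17 = NE4 AT THE RATE-RECORD HOME OF RECORD `YMDAG.UVSplit.RRec₁₁ 𝔯` (layer B, n22-e p457330): the K4 stub `S_N17 (RRec₁₁ 𝔯)` IS ONE
# scale-shift-rate sentence about def-B's merged β of record `betaMergedOfRecord₁₁ h.params` at the reading's K-uniform letters — run length eliminated, datum read
# through the key — and its ONE-APPLICATION closers (∀θ estimate ∕ split road ∕ U3 road) and output ((AF-0r) for the one-loop numbers of record)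

Cell `pub-ymgap`, HUMAN RULING D-0062, seat `pub-ymgap-dag-n17-c` gen 2 (lane s2; dag-lead TABLE v23 row n17 «U3 road … → consumer re-key»; WORDS-101 import order
`Record11` → `Record11DatumKey` → `RateRecord11` layer A → layer B `RRec₁₁` → consumers (n17 …)), companion 12 (§41–§42) of the N17 lineage.  THEOREMS ONLY; imports
layer B `…Theorems.BalabanUVNodesRateCarriersOfRecord11` (`RRec₁₁ 𝔯`, `u3OfRecord₁₁ θ u k`, `rateCarriersOfRecord₁₁`, `s_N17_rRec₁₁_iff`, `s_D4_rRec₁₁_iff`,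
`s_N18_rRec₁₁_iff`) and companion 11 `…N17AtRecord11Keys` (N17 at the datum key ∕ at layer A's level bundles); modifies nothing; every cited theorem used BY NAME.

WHY.  Layer B's one-application face `s_N17_rRec₁₁_iff` stops at `∀ … k, N17At D (u3OfRecord₁₁ h.params (𝔯.lit F h.params g₀ os).u3 k)` — the node statement at the
LEVEL-`k` bundle, on the datum.  Two facts finish the reading: N17 never reads the level carriers ∕ functionals and the letters are K-uniform BY TYPE (layer A's
`U3Letters₁₁`), so the run length `k` is IDLE (companion 11 `n17At_u3Level₁₁_iff`, `Iff.rfl`); and the key carries `D.βfun = betaOfRecord₁₁ F N h.params` (RR-2), equal to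
`betaMergedOfRecord₁₁ F N h.params` on the bundle's window `]0, h.params.γ]` (def-B).  Hence §41: `S_N17 (RRec₁₁ 𝔯)` ⟺ «for every datum of record and every `g₀, os`:
`ScaleShiftRate (cr·C₅·θ₅) ρ h.params.γ (betaMergedOfRecord₁₁ F N h.params)` at the letters of `(𝔯.lit F h.params g₀ os).u3`» — and the stub closes by ONE ∀θ
estimate about def-B's object (`s_N17_rRec₁₁_of_forall_admissible`), by the split road ((AF-0r) + `RemainderShiftRate` at the printed split of record), or by the U3
road `S_D4 → S_N18 → S_N17` (companion `…N17AtSpineCarriers`' `YMDAG.N17.s_N17_of_D4_N18` at `RRec₁₁ 𝔯`, N22 idle).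
* §41 THE STUB AT THE HOME, READ: `n17At_u3OfRecord₁₁_iff` (`Iff.rfl`, level-free), `n17At_u3OfRecord₁₁_iff_params`, `n17At_u3OfRecord₁₁_datumOfRecord₁₁_iff`,
  **`s_N17_rRec₁₁_iff_betaMergedOfRecord₁₁`**, `s_N17_rRec₁₁_iff_betaOfRecord₁₁`.
* §42 CLOSERS AND OUTPUT: `scaleShiftRate_mono_const` ([folklore] helper), **`s_N17_rRec₁₁_of_forall_admissible`**, `s_N17_rRec₁₁_of_split₁₁`, `s_N17_rRec₁₁_of_s_D4_s_N18`,
  `s_N17_rRec₁₁_of_readOut_ne5_forall_admissible` (the U3 road in ∀θ form at the bundles), `af0r_of_s_N17_rRec₁₁` (what the stub DELIVERS at every datum key: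
  (AF-0r) for `beta0OfRecord₁₁ h.params`, given `Beta0LimitExists` at coherent reference histories and `ρ < 1`).

HONEST FRAMING.  Kernel bookkeeping BY NAME; 0 sorry, 0 def; the reading `𝔯 : RateReading₁₁ N` is RESIDUAL (layer A's objects are containers — a skeleton quoting
`S_N17 (RRec₁₁ 𝔯)` NAMES its `𝔯`; for a junk `𝔯` the stub is junk); NE4 NOT IN PRINT ([Balaban1987RG1] p. 264) and NOT PROVED; every estimate ∕ (AF-0r) ∕
`RemainderShiftRate` ∕ (D4) ∕ NE5 ∕ `Beta0LimitExists` input is DISPLAYED; no datum of record claimed to exist (K0 = stmt-QuantumFields-19673); N17 NOT discharged;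
«A: n∕28» unmoved.  One finite four-torus at fixed ε per run — NOT infinite volume, NOT OS on ℝ⁴, NOT a mass gap, NOT Clay.
-/

noncomputable section

open scoped Matrix.Norms.L2Operator

namespace Summit.QuantumFields.YangMills.Theorems.BalabanUVNodesN17

open Filter Topology
open Literature.MathematicalPhysics.QuantumFieldTheory.Balaban1983to89
open Literature.MathematicalPhysics.QuantumFieldTheory.Balaban1983to89.FlowStep
open Literature.MathematicalPhysics.QuantumFieldTheory.Balaban1983to89.T4CouplingMatching
open Literature.MathematicalPhysics.QuantumFieldTheory.Balaban1983to89.T4Continuum (T4Family FiniteEpsData ULoop)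
open Literature.MathematicalPhysics.QuantumFieldTheory.Balaban1983to89.Node00
open Summit.QuantumFields.BalabanUV.T4Continuum.Spine.NE4 (NE4OnData ne4OnData_iff)
open YMDAG.UVSplit (Datum U3Carriers RateCarriers N17At N18At ReadOutAt S_N17 S_N18 S_D4 RateReading₁₁ RRec₁₁ u3OfRecord₁₁ rateCarriersOfRecord₁₁
  s_N17_rRec₁₁_iff s_N18_rRec₁₁_iff s_D4_rRec₁₁_iff)

variable {F : T4Family} {N : ℕ} [NeZero N]

/-! ## §41 THE STUB `S_N17 (RRec₁₁ 𝔯)` READ: one scale-shift-rate sentence about `betaMergedOfRecord₁₁ h.params`, level-free -/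

/-- **N17 AT NODE U3's BUNDLE OF RECORD OF RUN LENGTH `k` DOES NOT READ `k`** (`Iff.rfl`): `N17At D (u3OfRecord₁₁ θ u k) ↔ NE4OnData D (u.cr·u.C₅·u.θ₅) u.ρ θ.γ` — the
letters are the construction's K-uniform block, the window radius is `θ.γ`, the carriers ∕ functionals are not read. [cite: Balaban1987RG1, (1.20)-(1.22) p.264] -/
theorem n17At_u3OfRecord₁₁_iff (D : Datum F N) (θ : Stage11Params F N) (u : U3Objects₁₁) (k : ℕ) :
    N17At D (u3OfRecord₁₁ θ u k) ↔ NE4OnData D (u.cr * u.C₅ * u.θ₅) u.ρ θ.γ := Iff.rfl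

/-- **… AT A DATUM OF RECORD, READ AT ITS CANONICAL PARAMETER**: `N17At D (u3OfRecord₁₁ h.params u k) ↔ ScaleShiftRate (u.cr·u.C₅·u.θ₅) u.ρ h.params.γ
(betaMergedOfRecord₁₁ h.params)` (companion 11 `n17At_u3Level₁₁_iff_params` at `γ := h.params.γ`). [cite: Balaban1987RG1, (1.20)-(1.22) p.264] -/
theorem n17At_u3OfRecord₁₁_iff_params {D : Datum F N} (h : IsDatumOfRecord₁₁C F N D) (u : U3Objects₁₁) (k : ℕ) :
    N17At D (u3OfRecord₁₁ h.params u k) ↔ ScaleShiftRate (u.cr * u.C₅ * u.θ₅) u.ρ h.params.γ (betaMergedOfRecord₁₁ F N h.params) :=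
  n17At_u3Level₁₁_iff_params h u le_rfl k

/-- **… AT THE STAGE-11 DATUM OF ANY TUPLE `(θ, hP)`** (the ∀θ currency the estimate seats prove in): `N17At (datumOfRecord₁₁ θ hP) (u3OfRecord₁₁ θ u k) ↔
ScaleShiftRate (u.cr·u.C₅·u.θ₅) u.ρ θ.γ (betaMergedOfRecord₁₁ θ)` (companion 9 `n17At_datumOfRecord₁₁_iff_merged`). [cite: Balaban1987RG1, (1.20)-(1.22) p.264] -/
theorem n17At_u3OfRecord₁₁_datumOfRecord₁₁_iff (θ : Stage11Params F N) (hP : θ.Provisos₁₁) (u : U3Objects₁₁) (k : ℕ) :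
    N17At (datumOfRecord₁₁ F N θ hP) (u3OfRecord₁₁ θ u k) ↔ ScaleShiftRate (u.cr * u.C₅ * u.θ₅) u.ρ θ.γ (betaMergedOfRecord₁₁ F N θ) :=
  n17At_datumOfRecord₁₁_iff_merged θ hP (u3OfRecord₁₁ θ u k) le_rfl

variable (𝔯 : RateReading₁₁ N)

/-- **THE K4 STUB `S_N17` AT THE HOME OF RECORD IS ONE SENTENCE ABOUT def-B's MERGED β OF RECORD**: `S_N17 (RRec₁₁ 𝔯)` ⟺ for every datum of record `D` (canonical
parameter `h.params`), every bare sequence `g₀` and loop string `os`, the scale-shift rate `ScaleShiftRate (cr·C₅·θ₅) ρ h.params.γ (betaMergedOfRecord₁₁ F N h.params)`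
at the letters of the reading's U3 objects `(𝔯.lit F h.params g₀ os).u3` — layer B's `s_N17_rRec₁₁_iff` with the run length eliminated (§41's `Iff.rfl`) and the datum read
through the key.  NE4 NOT IN PRINT; the reading `𝔯` RESIDUAL. [cite: Balaban1987RG1, (1.20)-(1.22) p.264] -/
theorem s_N17_rRec₁₁_iff_betaMergedOfRecord₁₁ :
    S_N17 (RRec₁₁ 𝔯) ↔ ∀ (F : T4Family) (D : Datum F N) (h : IsDatumOfRecord₁₁C F N D) (g₀ : ℕ → ℝ) (os : List (ULoop F)),
      ScaleShiftRate ((𝔯.lit F h.params g₀ os).u3.cr * (𝔯.lit F h.params g₀ os).u3.C₅ * (𝔯.lit F h.params g₀ os).u3.θ₅)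
        (𝔯.lit F h.params g₀ os).u3.ρ h.params.γ (betaMergedOfRecord₁₁ F N h.params) := by
  rw [s_N17_rRec₁₁_iff]
  constructor
  · intro hS F D h g₀ os
    exact (n17At_u3OfRecord₁₁_iff_params h _ 0).mp (hS F D h g₀ os 0)
  · intro hin F D h g₀ os k
    exact (n17At_u3OfRecord₁₁_iff_params h _ k).mpr (hin F D h g₀ os)

/-- **… OR ABOUT THE β OF RECORD ITSELF** (`betaOfRecord₁₁ h.params = D.βfun`; same window): layer B's face with `k` eliminated and the datum read through the key, no
box bookkeeping (companion 11 `n17At_iff_betaOfRecord₁₁_params`). [cite: Balaban1987RG1, (1.20)-(1.22) p.264] -/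
theorem s_N17_rRec₁₁_iff_betaOfRecord₁₁ :
    S_N17 (RRec₁₁ 𝔯) ↔ ∀ (F : T4Family) (D : Datum F N) (h : IsDatumOfRecord₁₁C F N D) (g₀ : ℕ → ℝ) (os : List (ULoop F)),
      ScaleShiftRate ((𝔯.lit F h.params g₀ os).u3.cr * (𝔯.lit F h.params g₀ os).u3.C₅ * (𝔯.lit F h.params g₀ os).u3.θ₅)
        (𝔯.lit F h.params g₀ os).u3.ρ h.params.γ (betaOfRecord₁₁ F N h.params) := by
  rw [s_N17_rRec₁₁_iff]
  constructor
  · intro hS F D h g₀ os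
    exact (n17At_iff_betaOfRecord₁₁_params h _).mp (hS F D h g₀ os 0)
  · intro hin F D h g₀ os k
    exact (n17At_iff_betaOfRecord₁₁_params h _).mpr (hin F D h g₀ os)

/-! ## §42 THE ONE-APPLICATION CLOSERS OF `S_N17 (RRec₁₁ 𝔯)` AND WHAT IT DELIVERS -/

/-- `ScaleShiftRate` is monotone in the constant (nonnegative rate). [folklore] -/
theorem scaleShiftRate_mono_const {c c' ρ γ : ℝ} {β : HBeta} (hcc : c ≤ c') (hρ : 0 ≤ ρ) (h : ScaleShiftRate c ρ γ β) :
    ScaleShiftRate c' ρ γ β := fun k w hw =>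
  (h k w hw).trans (mul_le_mul_of_nonneg_right hcc (pow_nonneg hρ k))

/-- **THE ONE-APPLICATION CLOSER (∀θ estimate ⟹ the stub at the home)**: if for EVERY admissible Stage-11 parameter `θ` with provisos, every `g₀, os`, def-B's merged β
of record has the scale-shift rate `ScaleShiftRate (cr·C₅·θ₅) ρ θ.γ (betaMergedOfRecord₁₁ F N θ)` at the letters of `(𝔯.lit F θ g₀ os).u3` — the shape an estimate seat
proves, NE4 = rows NE2 ∕ NE3 ∕ (D4) composed (NOT IN PRINT) — then `S_N17 (RRec₁₁ 𝔯)` (instantiate at the canonical parameter of each datum key).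
[cite: Balaban1987RG1, (1.20)-(1.22) p.264] -/
theorem s_N17_rRec₁₁_of_forall_admissible
    (hin : ∀ (F : T4Family) (θ : Stage11Params F N) (hP : θ.Provisos₁₁), θ.Admissible → ∀ (g₀ : ℕ → ℝ) (os : List (ULoop F)),
      ScaleShiftRate ((𝔯.lit F θ g₀ os).u3.cr * (𝔯.lit F θ g₀ os).u3.C₅ * (𝔯.lit F θ g₀ os).u3.θ₅) (𝔯.lit F θ g₀ os).u3.ρ θ.γ
        (betaMergedOfRecord₁₁ F N θ)) :
    S_N17 (RRec₁₁ 𝔯) :=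
  (s_N17_rRec₁₁_iff_betaMergedOfRecord₁₁ 𝔯).mpr fun F _ h g₀ os => hin F h.params h.provisos h.admissible g₀ os

/-- **THE SPLIT ROAD AT THE HOME** («β⁰ conv + β¹ shift» through the printed split of record): if for every admissible `θ` with provisos, every `g₀, os`, the letters
`u := (𝔯.lit F θ g₀ os).u3` have `0 ≤ u.ρ ≤ 1` and there are constants `c₀ ≥ 0`, `c₁` with `2c₀ + c₁ ≤ u.cr·u.C₅·u.θ₅`, (AF-0r) `|beta0OfRecord₁₁ θ k − β⁰_∞| ≤ c₀·u.ρ^k`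
(N15 ∕ NODE O currency) and `RemainderShiftRate (oneLoopSplitOfRecord₁₁ θ) c₁ u.ρ θ.γ` (N16 ∕ N18), then `S_N17 (RRec₁₁ 𝔯)` (`T4CouplingMatching.scaleShiftRate_of_split` at
the split of record, companion 9's `Iff.rfl`, monotonicity in the constant).  Both binders UNPRINTED, displayed. [cite: Balaban1987RG1, (2.12)-(2.14) p.268] -/
theorem s_N17_rRec₁₁_of_split₁₁
    (hin : ∀ (F : T4Family) (θ : Stage11Params F N) (hP : θ.Provisos₁₁), θ.Admissible → ∀ (g₀ : ℕ → ℝ) (os : List (ULoop F)),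
      0 ≤ (𝔯.lit F θ g₀ os).u3.ρ ∧ (𝔯.lit F θ g₀ os).u3.ρ ≤ 1 ∧
      ∃ binf c₀ c₁ : ℝ, 0 ≤ c₀ ∧ 2 * c₀ + c₁ ≤ (𝔯.lit F θ g₀ os).u3.cr * (𝔯.lit F θ g₀ os).u3.C₅ * (𝔯.lit F θ g₀ os).u3.θ₅ ∧
        (∀ k, |beta0OfRecord₁₁ F N θ k - binf| ≤ c₀ * (𝔯.lit F θ g₀ os).u3.ρ ^ k) ∧
        RemainderShiftRate (oneLoopSplitOfRecord₁₁ F N θ) c₁ (𝔯.lit F θ g₀ os).u3.ρ θ.γ) :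
    S_N17 (RRec₁₁ 𝔯) := by
  rw [s_N17_rRec₁₁_iff]
  intro F D h g₀ os k
  obtain ⟨hρ0, hρ1, binf, c₀, c₁, hc₀, hcc, hconv, hrem⟩ := hin F h.params h.provisos h.admissible g₀ os
  rw [n17At_u3OfRecord₁₁_iff, N17_iff_betaOfRecord₁₁_params h]
  exact scaleShiftRate_mono_const hcc hρ0 (scaleShiftRate_of_split (oneLoopSplitOfRecord₁₁ F N h.params) hρ0 hρ1 hc₀ hconv hrem)

/-- **THE U3 ROAD AT THE HOME, BY NAME**: `S_D4 (RRec₁₁ 𝔯) → S_N18 (RRec₁₁ 𝔯) → S_N17 (RRec₁₁ 𝔯)` — companion `…N17AtSpineCarriers`' refinement-generic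
`YMDAG.N17.s_N17_of_D4_N18` at the home (N22 idle); recorded so the K4 skeleton at `RRec₁₁ 𝔯` can quote N17 as GLUE. [cite: Balaban1987RG1, (1.20)-(1.22) p.264] -/
theorem s_N17_rRec₁₁_of_s_D4_s_N18 (hD4 : S_D4 (RRec₁₁ 𝔯)) (h18 : S_N18 (RRec₁₁ 𝔯)) : S_N17 (RRec₁₁ 𝔯) :=
  YMDAG.N17.s_N17_of_D4_N18 (RRec₁₁ 𝔯) hD4 h18

/-- **THE U3 ROAD IN ∀θ FORM AT THE BUNDLES OF RECORD**: the (D4) read-out binders at `(datumOfRecord₁₁ θ hP, u3OfRecord₁₁ θ (𝔯.lit F θ g₀ os).u3 k)` and NE5 at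
`u3OfRecord₁₁ θ (𝔯.lit F θ g₀ os).u3 k`, for every admissible `θ` with provisos, every `g₀, os, k` ⟹ `S_N17 (RRec₁₁ 𝔯)` (pointwise `YMDAG.N17.n17At_of_readOutAt`, then layer B's
`s_N17_rRec₁₁_iff` at the canonical parameters).  (D4) and NE5 UNPRINTED — binders. [cite: Balaban1987RG1, (1.20)-(1.22) p.264] -/
theorem s_N17_rRec₁₁_of_readOut_ne5_forall_admissible
    (hD4 : ∀ (F : T4Family) (θ : Stage11Params F N) (hP : θ.Provisos₁₁), θ.Admissible → ∀ (g₀ : ℕ → ℝ) (os : List (ULoop F)) (k : ℕ),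
      ReadOutAt (datumOfRecord₁₁ F N θ hP) (u3OfRecord₁₁ θ (𝔯.lit F θ g₀ os).u3 k))
    (h18 : ∀ (F : T4Family) (θ : Stage11Params F N) (hP : θ.Provisos₁₁), θ.Admissible → ∀ (g₀ : ℕ → ℝ) (os : List (ULoop F)) (k : ℕ),
      N18At (u3OfRecord₁₁ θ (𝔯.lit F θ g₀ os).u3 k)) :
    S_N17 (RRec₁₁ 𝔯) := by
  rw [s_N17_rRec₁₁_iff]
  intro F D h g₀ os k
  have h17 := YMDAG.N17.n17At_of_readOutAt _ (hD4 F h.params h.provisos h.admissible g₀ os k) (h18 F h.params h.provisos h.admissible g₀ os k)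
  rwa [← h.eq_datumOfRecord₁₁] at h17

/-- **WHAT THE STUB AT THE HOME DELIVERS: (AF-0r) FOR THE ONE-LOOP NUMBERS OF RECORD AT EVERY DATUM KEY.**  `S_N17 (RRec₁₁ 𝔯)`, a datum of record `D` with canonical
parameter `θ := h.params`, `g₀, os` with letters `u := (𝔯.lit F θ g₀ os).u3` satisfying `u.ρ < 1`, and the definer's one-sided limit `Beta0LimitExists (betaMergedOfRecord₁₁ θ)
θ.v₀` at COHERENT reference histories with entries in `]0, θ.γ]` ⟹ `∃ β⁰_∞, |beta0OfRecord₁₁ θ k − β⁰_∞| ≤ (u.cr·u.C₅·u.θ₅ ∕ (1 − u.ρ))·u.ρ^k` — the `hconv` input of K2's engine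
at the split of record (companion 10 `af0r_oneLoopSplitOfRecord₁₁_iff`), SUPPLIED by the node (companion 11 `af0r_params_of_N17`). [cite: Balaban1987RG1, (2.12)-(2.14) p.268] -/
theorem af0r_of_s_N17_rRec₁₁ (hS : S_N17 (RRec₁₁ 𝔯)) {F : T4Family} {D : Datum F N} (h : IsDatumOfRecord₁₁C F N D) (g₀ : ℕ → ℝ)
    (os : List (ULoop F)) (hρ1 : (𝔯.lit F h.params g₀ os).u3.ρ < 1)
    (hlim : Beta0LimitExists (betaMergedOfRecord₁₁ F N h.params) h.params.v₀) (hcoh : ∀ k, Fin.tail (h.params.v₀ (k + 1)) = h.params.v₀ k)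
    (hadm : ∀ k i, 0 < h.params.v₀ k i ∧ h.params.v₀ k i ≤ h.params.γ) :
    ∃ binf : ℝ, ∀ k, |beta0OfRecord₁₁ F N h.params k - binf| ≤
      (𝔯.lit F h.params g₀ os).u3.cr * (𝔯.lit F h.params g₀ os).u3.C₅ * (𝔯.lit F h.params g₀ os).u3.θ₅ /
        (1 - (𝔯.lit F h.params g₀ os).u3.ρ) * (𝔯.lit F h.params g₀ os).u3.ρ ^ k :=
  af0r_params_of_N17 h le_rfl h.gamma_pos hρ1 hlim hcoh hadm
    ((n17At_u3OfRecord₁₁_iff D h.params _ 0).mp ((s_N17_rRec₁₁_iff 𝔯).mp hS F D h g₀ os 0))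

end Summit.QuantumFields.YangMills.Theorems.BalabanUVNodesN17

end
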